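import Literature.NumberTheory.Transcendental.CijsouwWaldschmidt1977Main
import HarnessLib

/-!
# Waldschmidt 1980, (3.1): the size hypotheses of a set-up, RECORD-FREE

Support file (one `Prop`-valued structure and proved lemmas; no named fact).  Waldschmidt's
hypothesis (3.1) linking the data `(αⱼ, θ; bⱼ, b_θ)` of a Cijsouw–Waldschmidt set-up `S` to real
sizes: `log H(αⱼ), |log αⱼ| ≤ Vⱼ`, `log H(θ), |log θ| ≤ V_θ`, `|bⱼ|, |b_θ| ≤ e^W`.  The tree's
`CW77.Setup.W80Hyp P` is this predicate at the fields of the archimedean record `W80Par`; here it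
is stated for bare reals `V, V_θ, W`, so that ANY parameter record — in particular the `p`-adic one
of the cell `abc-stewartyu` (`Summit.ABC.StewartYu.PadicW80Par`, a Summits-side structure that may
not define propositions) — can use it as `S.SizeHyp P.Vs P.Vel P.Wb`.  Lemmas (name-for-name with
the `W80Hyp` ones, `Vall = Fin.snoc V V_θ`): `log_hgt_all_le`, `hgt_le`, `hgt_pow_le`,
`one_add_sum_abs_l_le`, `abs_β_le`, `heightProd_le`, and the record-free coefficient powers
`natAbs_bθ_pow_le_exp`, `natAbs_b_pow_le_exp`, `mono`, `sum_snoc`; and the bridge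
`log_hgt_eq_logHeight₁` to Mathlib's height.

## References
* [Waldschmidt1980] M. Waldschmidt, *A lower bound for linear forms in logarithms*, Acta Arith. 37
  (1980), 257–283 — §3.1, hypothesis (3.1) (p. 263).
-/

noncomputable section

open Finset Real Height

namespace Literature.NumberTheory.Transcendental.CW77

/-- `log H(q) = h(q)` (Mathlib's logarithmic height on `ℚ`). [cite: Waldschmidt1980, §3.1 (p. 263)] -/
theorem log_hgt_eq_logHeight₁ (q : ℚ) : Real.log (hgt q) = logHeight₁ q := by
  rw [Rat.logHeight₁_eq_log_max]; rfl

namespace Setup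

variable (S : Setup)

/-- **Waldschmidt's size hypotheses (3.1) for the set-up `S` at bare sizes `V, V_θ, W`**: the free
generators have `log H(αⱼ), |log αⱼ| ≤ Vⱼ`, the eliminated one `log H(θ), |log θ| ≤ V_θ`, the
coefficients `|bⱼ|, |b_θ| ≤ e^W`. [cite: Waldschmidt1980, §3.1 (3.1) (p. 263)] -/
structure SizeHyp (V : Fin S.d → ℝ) (Vθ W : ℝ) : Prop where
  /-- `log H(αⱼ) ≤ Vⱼ` -/
  hH : ∀ j, Real.log (hgt (S.α j)) ≤ V j
  /-- `|log αⱼ| ≤ Vⱼ` -/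
  hl : ∀ j, |S.l j| ≤ V j
  /-- `log H(θ) ≤ V_θ` -/
  hHθ : Real.log (hgt S.θ) ≤ Vθ
  /-- `|log θ| ≤ V_θ` -/
  hlθ : |S.lθ| ≤ Vθ
  /-- `|bⱼ| ≤ e^W` -/
  hb : ∀ j, |(S.b j : ℝ)| ≤ Real.exp W
  /-- `|b_θ| ≤ e^W` -/
  hbθ : |(S.bθ : ℝ)| ≤ Real.exp W

variable {S}
variable {V : Fin S.d → ℝ} {Vθ W : ℝ} (hy : S.SizeHyp V Vθ W)
include hy

/-- `log H(allᵢ) ≤ Vallᵢ` with `Vall = Fin.snoc V V_θ`. [cite: Waldschmidt1980, §3.1 (3.1) (p. 263)] -/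
theorem SizeHyp.log_hgt_all_le (i : Fin (S.d + 1)) :
    Real.log (hgt (S.all i)) ≤ (Fin.snoc V Vθ : Fin (S.d + 1) → ℝ) i := by
  refine Fin.lastCases ?_ (fun j => ?_) i
  · rw [Fin.snoc_last]; unfold all; rw [Fin.snoc_last]; exact hy.hHθ
  · rw [Fin.snoc_castSucc]; unfold all; rw [Fin.snoc_castSucc]; exact hy.hH j

/-- `H(allᵢ) ≤ exp Vallᵢ`. [cite: Waldschmidt1980, §3.1 (3.1) (p. 263)] -/
theorem SizeHyp.hgt_le (i : Fin (S.d + 1)) :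
    hgt (S.all i) ≤ Real.exp ((Fin.snoc V Vθ : Fin (S.d + 1) → ℝ) i) := by
  have := hy.log_hgt_all_le i
  rwa [Real.log_le_iff_le_exp (hgt_pos _)] at this

/-- `H(allᵢ)^e ≤ exp(e Vallᵢ)`. [cite: Waldschmidt1980, §3.1 (3.1) (p. 263)] -/
theorem SizeHyp.hgt_pow_le (i : Fin (S.d + 1)) (e : ℕ) :
    hgt (S.all i) ^ e ≤ Real.exp (e * (Fin.snoc V Vθ : Fin (S.d + 1) → ℝ) i) := by
  rw [Real.exp_nat_mul]
  exact pow_le_pow_left₀ (hgt_pos _).le (hy.hgt_le i) e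

/-- `1 + ∑ |lⱼ| ≤ 1 + ∑ Vⱼ`. [cite: Waldschmidt1980, §3.1 (3.1) (p. 263)] -/
theorem SizeHyp.one_add_sum_abs_l_le : 1 + ∑ j, |S.l j| ≤ 1 + ∑ j, V j := by
  linarith [sum_le_sum fun j (_ : j ∈ univ) => hy.hl j]

/-- `|βⱼ| ≤ e^W`. [cite: Waldschmidt1980, §3.1 (3.1) (p. 263)] -/
theorem SizeHyp.abs_β_le (j : Fin S.d) : |(S.β j : ℝ)| ≤ Real.exp W := by
  unfold β
  push_cast
  rw [abs_div, abs_neg]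
  have hbθ : (1 : ℝ) ≤ |(S.bθ : ℝ)| := by
    have h := Int.one_le_abs S.bθ_ne
    exact_mod_cast h
  calc |(S.b j : ℝ)| / |(S.bθ : ℝ)| ≤ |(S.b j : ℝ)| / 1 :=
        div_le_div_of_nonneg_left (abs_nonneg _) one_pos hbθ
    _ = |(S.b j : ℝ)| := div_one _
    _ ≤ Real.exp W := hy.hb j

/-- **`P(all) ≤ exp(∑ Vallᵢ)`** (the height product of the Liouville estimate).
[cite: Waldschmidt1980, §3.1 (3.1) (p. 263)] -/
theorem SizeHyp.heightProd_le :
    heightProd S.all ≤ Real.exp (∑ i, (Fin.snoc V Vθ : Fin (S.d + 1) → ℝ) i) := by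
  unfold heightProd
  rw [Real.exp_sum]
  exact prod_le_prod (fun i _ => (hgt_pos _).le) fun i _ => hy.hgt_le i

omit hy in
/-- `∑ᵢ Vallᵢ = ∑ⱼ Vⱼ + V_θ`. [cite: Waldschmidt1980, §3.1 (p. 263)] -/
theorem SizeHyp.sum_snoc : ∑ i, (Fin.snoc V Vθ : Fin (S.d + 1) → ℝ) i = (∑ j, V j) + Vθ := by
  rw [Fin.sum_univ_castSucc]; simp

/-- `|b_θ|^k ≤ e^{k W}` (as naturals cast to `ℝ`). [cite: Waldschmidt1980, §3.3 (p. 269)] -/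
theorem SizeHyp.natAbs_bθ_pow_le_exp (k : ℕ) :
    ((S.bθ.natAbs ^ k : ℕ) : ℝ) ≤ Real.exp (k * W) := by
  push_cast
  rw [Nat.cast_natAbs, Int.cast_abs, Real.exp_nat_mul]
  exact pow_le_pow_left₀ (abs_nonneg _) hy.hbθ k

/-- `|bⱼ|^k ≤ e^{k W}`. [cite: Waldschmidt1980, §3.3 (p. 269)] -/
theorem SizeHyp.natAbs_b_pow_le_exp (j : Fin S.d) (k : ℕ) :
    (((S.b j).natAbs ^ k : ℕ) : ℝ) ≤ Real.exp (k * W) := by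
  push_cast
  rw [Nat.cast_natAbs, Int.cast_abs, Real.exp_nat_mul]
  exact pow_le_pow_left₀ (abs_nonneg _) (hy.hb j) k

/-- Monotonicity in the sizes. [cite: Waldschmidt1980, §3.1 (p. 263)] -/
theorem SizeHyp.mono {V' : Fin S.d → ℝ} {Vθ' W' : ℝ} (hV : ∀ j, V j ≤ V' j) (hVθ : Vθ ≤ Vθ')
    (hW : W ≤ W') : S.SizeHyp V' Vθ' W' where
  hH j := (hy.hH j).trans (hV j)
  hl j := (hy.hl j).trans (hV j)
  hHθ := hy.hHθ.trans hVθ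
  hlθ := hy.hlθ.trans hVθ
  hb j := (hy.hb j).trans (Real.exp_le_exp.mpr hW)
  hbθ := hy.hbθ.trans (Real.exp_le_exp.mpr hW)

end Setup

end Literature.NumberTheory.Transcendental.CW77

end
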